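import Summits.ABC.ABC.Theorems.PadicPrimesYuNinetyThreeModFourTransfer
import HarnessLib

set_option linter.dupNamespace false

/-!
# Route PadicPrimesYuNinety: the TRANSFER from ONE odd-prime engine to BOTH odd residue-class cruxes
# (`YuNinetyThreeModFour`, stmt-ABC-19249, AND `YuNinetyOneModFour`, stmt-ABC-19250)

`Summits/ABC/ABC/Theorems/PadicPrimesYuNinetyOddEngineTransfer.lean` — cell `abc-stewartyu`, seat p3
(g2), sequel to p1's `PadicPrimesYuNinetyThreeModFourTransfer.lean` (whose proof is re-run here with the
residue-class hypothesis made a parameter).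

Design memo HOME/p3/memo-03-odd-twist-engine.md (attached as evidence on both items): the K = ℚ
Teichmüller-twist engine with exponent classes modulo `(p−1)/2` and one parity bit per half point
meets only the roots of unity `±1, ±ι` (`ι² = −1`), so its Kummer input is the SIGNED square-class
condition of the registered skeleton and it does not care whether `p ≡ 1` or `3 (mod 4)`. Hence ONE
engine statement — `EngineThreeModFour` of the birth skeleton with `p % 4 = 3` replaced by a
predicate `P p` (below: any `P` with `¬ P 2`; the intended instance is `P p := p ≠ 2`) — should serve
both cruxes. This file does the bookkeeping half of that claim, kernel-checked:

* `padicPrimesYuNinety_residueClass_of_engine` — for ANY predicate `P` on primes with `¬ P 2`: the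
  engine bound at the primes with `P p` (product shape `C(m)·p·∏(Vⱼ/log p)·W·(log Vmax + log p)/(log p)²`,
  `C(m) ≤ c₁^m m^m`, arbitrary rational `p`-adic units, signed Kummer condition) gives the crux text
  at the primes with `P p` (`c₅ = 5c₁`); the proof is p1's, verbatim, with `p % 4 = 3 ↦ P p`
  (it used the residue class only to feed the engine and to get `p ≥ 3`);
* `padicPrimesYuNinety_oneModFour_of_oddEngine` / `…_threeModFour_of_oddEngine` — from the odd engine
  (`P p := p ≠ 2`), the cruxes `Summit.ABC.ABC.Theses.PadicPrimesYuNinety.YuNinetyOneModFour` and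
  `….YuNinetyThreeModFour` BY NAME;
* `padicPrimesYuNinety_oneModFour_of_engineOne` — the same from an engine stated at `p ≡ 1 (mod 4)`
  only (in case the lead keeps two engine stubs).

Everything is [folklore] bookkeeping. WHAT THIS IS NOT: no engine is proved here; whether ONE engine
is buildable for all odd `p` is the claim of memo-03 §2 (to be refereed), not of this file.
-/

noncomputable section

open Finset Real Height

namespace Summit.ABC.ABC.Theorems

/-- **Generic residue-class transfer.** For a predicate `P` on primes with `¬ P 2`: an engine bound
`ord_p(∏ αⱼ^{bⱼ} − 1) ≤ C(m)·p·∏(Vⱼ/log p)·W·(log Vmax + log p)/(log p)²` (`C(m) ≤ c₁^m m^m`) for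
rational `p`-adic units (multiplicatively independent, no signed sub-product a square) at every prime
with `P p` gives, at every prime with `P p`, the crux text of route `PadicPrimesYuNinety` with
`c₅ = 5c₁`: `ord_p(∏_{q∈S} q^{e_q} − 1) < (c₅ #S)^{#S}·p²·log B·log log max(4, sup S)·∏ log max(4,q)`.
Proof = p1's `padicPrimesYuNinety_threeModFour_of_engine` with the residue class a parameter.
[folklore] -/
theorem padicPrimesYuNinety_residueClass_of_engine (P : ℕ → Prop) (hP2 : ¬ P 2)
    (hE : ∃ (C : ℕ → ℝ) (c₁ : ℝ), 1 ≤ c₁ ∧ (∀ m, 0 ≤ C m ∧ C m ≤ c₁ ^ m * (m : ℝ) ^ m) ∧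
      ∀ (p : ℕ), p.Prime → P p → ∀ (m : ℕ) (α : Fin m → ℚ) (b : Fin m → ℤ) (V : Fin m → ℝ)
        (Vmax W : ℝ),
        (∀ j, α j ≠ 0 ∧ padicValRat p (α j) = 0) →
        (∀ μ : Fin m → ℤ, ∏ j, α j ^ μ j = 1 → μ = 0) →
        (∀ T : Finset (Fin m), T.Nonempty → ¬ IsSquare (∏ j ∈ T, α j) ∧ ¬ IsSquare (-∏ j ∈ T, α j)) →
        (∀ j, Height.logHeight₁ (α j) ≤ V j) → (∀ j, Real.log p ≤ V j) → (∀ j, V j ≤ Vmax) →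
        b ≠ 0 → (∀ j, Real.log (max 3 (|b j| : ℝ)) ≤ W) →
        (padicValRat p (∏ j, α j ^ b j - 1) : ℝ) ≤
          C m * p * (∏ j, V j / Real.log p) * W * (Real.log Vmax + Real.log p) / Real.log p ^ 2) :
    ∃ c₅ : ℝ, ∀ (p : ℕ), p.Prime → P p → ∀ (S : Finset ℕ), (∀ q ∈ S, q.Prime) → p ∉ S →
      S.Nonempty → ∀ (e : ℕ → ℤ) (B : ℝ), 3 ≤ B → (∀ q ∈ S, (|e q| : ℝ) ≤ B) →
      ∏ q ∈ S, (q : ℚ) ^ e q ≠ 1 →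
      (padicValRat p (∏ q ∈ S, (q : ℚ) ^ e q - 1) : ℝ) <
        (c₅ * S.card) ^ S.card * (p : ℝ) ^ 2 * Real.log B *
          Real.log (Real.log ((max 4 (S.sup id) : ℕ) : ℝ)) * ∏ q ∈ S, Real.log ((max 4 q : ℕ) : ℝ) := by
  classical
  obtain ⟨C, c₁, hc₁, hC, hA⟩ := hE
  refine ⟨5 * c₁, ?_⟩
  intro p hp hPp S hS hpS hSne e B hB heB hne1
  have hp2 : p ≠ 2 := fun h => hP2 (h ▸ hPp)
  haveI := Fact.mk hp
  -- enumeration of `S`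
  set m : ℕ := S.card with hm
  have hm1 : 1 ≤ m := Finset.card_pos.mpr hSne
  set φ : Fin m ≃ S := S.equivFin.symm with hφ
  set q : Fin m → ℕ := fun i => (φ i : ℕ) with hqdef
  have hqS : ∀ i, q i ∈ S := fun i => (φ i).2
  have hqP : ∀ i, (q i).Prime := fun i => hS _ (hqS i)
  have hinj : Function.Injective q := fun i j hij => φ.injective (Subtype.ext hij)
  have hqp : ∀ i, q i ≠ p := fun i h => hpS (h ▸ hqS i)
  have hreidx : ∀ {M : Type} [CommMonoid M] (f : ℕ → M), ∏ i, f (q i) = ∏ x ∈ S, f x := by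
    intro M _ f
    rw [← Finset.prod_coe_sort S f]
    exact Fintype.prod_equiv φ (fun i => f (q i)) (fun x => f x) (fun i => rfl)
  -- the data fed to the engine
  set L : ℝ := Real.log p with hL
  set M4 : ℝ := ((max 4 (S.sup id) : ℕ) : ℝ) with hM4
  set X : ℝ := Real.log M4 with hX
  set α : Fin m → ℚ := fun j => (q j : ℚ) with hα
  set b : Fin m → ℤ := fun j => e (q j) with hb
  set V : Fin m → ℝ := fun j => L * Real.log ((max 4 (q j) : ℕ) : ℝ) with hV
  set Vmax : ℝ := L * X with hVmax
  set W : ℝ := Real.log B with hW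
  -- numerics of `p ≥ 3`
  have hp3 : 3 ≤ p := by have := hp.two_le; omega
  have hp3R : (3 : ℝ) ≤ p := by exact_mod_cast hp3
  have hpR0 : (0 : ℝ) < p := by linarith
  have hL1 : 1 < L := by
    have h3 : (1 : ℝ) < Real.log 3 := by
      rw [Real.lt_log_iff_exp_lt (by norm_num)]
      exact Real.exp_one_lt_d9.trans (by norm_num)
    exact h3.trans_le (Real.log_le_log (by norm_num) hp3R)
  have hL0 : 0 < L := by linarith
  have hX1 : (1.38 : ℝ) ≤ X := (loglog_max_four_bounds (S.sup id)).1
  have hℓ : (0.27 : ℝ) ≤ Real.log X := (loglog_max_four_bounds (S.sup id)).2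
  have hX0 : 0 < X := by linarith
  have hlogmax : ∀ j, (1.38 : ℝ) ≤ Real.log ((max 4 (q j) : ℕ) : ℝ) := fun j =>
    (loglog_max_four_bounds (q j)).1
  -- the engine's hypotheses
  have h1 : ∀ j, α j ≠ 0 ∧ padicValRat p (α j) = 0 := fun j =>
    ⟨by simp only [hα]; exact_mod_cast (hqP j).ne_zero,
      Literature.Barriers.ABC.StewartTijdemanGeneric.padicValRat_natCast_prime_of_ne hp (hqP j) (hqp j)⟩
  have h2 : ∀ μ : Fin m → ℤ, ∏ j, α j ^ μ j = 1 → μ = 0 := fun μ hμ =>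
    Literature.Barriers.ABC.StewartTijdemanGeneric.prime_family_zpow_eq_one hqP hinj hμ
  have h3 : ∀ T : Finset (Fin m), T.Nonempty →
      ¬ IsSquare (∏ j ∈ T, α j) ∧ ¬ IsSquare (-∏ j ∈ T, α j) := fun T hT =>
    not_isSquare_prod_distinct_primes q hqP hinj T hT
  have h4 : ∀ j, logHeight₁ (α j) ≤ V j := by
    intro j
    haveI : NeZero (q j) := ⟨(hqP j).ne_zero⟩
    have hh : logHeight₁ (α j) = Real.log (q j) := by
      simp only [hα]; exact Rat.logHeight₁_natCast (q j)
    rw [hh]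
    have hq4 : Real.log (q j) ≤ Real.log ((max 4 (q j) : ℕ) : ℝ) :=
      Real.log_le_log (by exact_mod_cast (hqP j).pos) (by exact_mod_cast le_max_right 4 (q j))
    calc Real.log (q j) ≤ Real.log ((max 4 (q j) : ℕ) : ℝ) := hq4
      _ ≤ L * Real.log ((max 4 (q j) : ℕ) : ℝ) :=
          le_mul_of_one_le_left (by linarith [hlogmax j]) hL1.le
  have h5 : ∀ j, Real.log p ≤ V j := fun j => by
    show L ≤ L * Real.log ((max 4 (q j) : ℕ) : ℝ)
    exact le_mul_of_one_le_right hL0.le (by linarith [hlogmax j])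
  have h6 : ∀ j, V j ≤ Vmax := by
    intro j
    have hle : ((max 4 (q j) : ℕ) : ℝ) ≤ M4 := by
      rw [hM4]
      exact_mod_cast max_le_max le_rfl (Finset.le_sup (f := id) (hqS j))
    have hpos : (0 : ℝ) < ((max 4 (q j) : ℕ) : ℝ) := by
      exact_mod_cast lt_of_lt_of_le (by norm_num) (le_max_left 4 (q j))
    exact mul_le_mul_of_nonneg_left (Real.log_le_log hpos hle) hL0.le
  have hprodQ : ∏ j, α j ^ b j = ∏ x ∈ S, (x : ℚ) ^ e x := hreidx (fun x => (x : ℚ) ^ e x)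
  have h7 : b ≠ 0 := by
    intro h0
    apply hne1
    rw [← hprodQ]
    exact Finset.prod_eq_one fun j _ => by rw [show b j = 0 from congrFun h0 j, zpow_zero]
  have hB0 : 0 < Real.log B := Real.log_pos (by linarith)
  have h8 : ∀ j, Real.log (max 3 (|b j| : ℝ)) ≤ W := by
    intro j
    have hle : max 3 (|b j| : ℝ) ≤ B := max_le hB (by simp only [hb]; exact heB _ (hqS j))
    exact Real.log_le_log (lt_of_lt_of_le (by norm_num) (le_max_left _ _)) hle
  -- the engine
  have key := hA p hp hPp m α b V Vmax W h1 h2 h3 h4 h5 h6 h7 h8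
  rw [hprodQ] at key
  -- `∏ Vⱼ / log p = ∏_{q ∈ S} log (max 4 q)`
  set PL : ℝ := ∏ x ∈ S, Real.log ((max 4 x : ℕ) : ℝ) with hPL
  have hPV : ∏ j, V j / Real.log p = PL := by
    rw [hPL, ← hreidx (fun x => Real.log ((max 4 x : ℕ) : ℝ))]
    refine Finset.prod_congr rfl fun j _ => ?_
    simp only [hV]
    rw [← hL]
    field_simp
  have hPL0 : 0 < PL := Finset.prod_pos fun x _ => by
    linarith [(loglog_max_four_bounds x).1]
  have hW0 : 0 < W := Real.log_pos (by linarith)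
  have hlX0 : 0 < Real.log X := by linarith
  -- the garbage `(log Vmax + log p)/(log p)² ≤ 5 log X`
  have hgarb : (Real.log Vmax + Real.log p) / Real.log p ^ 2 ≤ 5 * Real.log X := by
    rw [← hL, hVmax, Real.log_mul hL0.ne' hX0.ne']
    have hlogL : Real.log L ≤ L - 1 := Real.log_le_sub_one_of_pos hL0
    rw [div_le_iff₀ (by positivity)]
    have hL21 : (0 : ℝ) ≤ L ^ 2 - 1 := by nlinarith
    nlinarith [sq_nonneg (L - 1), mul_nonneg hlX0.le hL21]
  -- assemble
  set v : ℝ := (padicValRat p (∏ x ∈ S, (x : ℚ) ^ e x - 1) : ℝ) with hv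
  have hCm := hC m
  have hrest0 : 0 ≤ (p : ℝ) * PL * W * (5 * Real.log X) :=
    mul_nonneg (mul_nonneg (mul_nonneg hpR0.le hPL0.le) hW0.le) (by linarith)
  have hstep1 : v ≤ C m * p * PL * W * (5 * Real.log X) := by
    have h0 : 0 ≤ C m * p * PL * W :=
      mul_nonneg (mul_nonneg (mul_nonneg hCm.1 hpR0.le) hPL0.le) hW0.le
    calc v ≤ C m * p * (∏ j, V j / Real.log p) * W * (Real.log Vmax + Real.log p) /
          Real.log p ^ 2 := key
      _ = C m * p * PL * W * ((Real.log Vmax + Real.log p) / Real.log p ^ 2) := by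
          rw [hPV, mul_div_assoc]
      _ ≤ C m * p * PL * W * (5 * Real.log X) := mul_le_mul_of_nonneg_left hgarb h0
  have hA0 : 0 < W * Real.log X * PL := mul_pos (mul_pos hW0 hlX0) hPL0
  have henv : 5 * (c₁ ^ m * (m : ℝ) ^ m) ≤ (5 * c₁ * m) ^ m := by
    rw [mul_pow, mul_pow]
    have h5 : (5 : ℝ) ≤ 5 ^ m := by
      calc (5 : ℝ) = 5 ^ 1 := (pow_one _).symm
        _ ≤ 5 ^ m := pow_le_pow_right₀ (by norm_num) hm1
    have hc0 : 0 ≤ c₁ ^ m * (m : ℝ) ^ m := by positivity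
    calc 5 * (c₁ ^ m * (m : ℝ) ^ m) ≤ 5 ^ m * (c₁ ^ m * (m : ℝ) ^ m) :=
          mul_le_mul_of_nonneg_right h5 hc0
      _ = 5 ^ m * c₁ ^ m * (m : ℝ) ^ m := by ring
  have hpp : (p : ℝ) < (p : ℝ) ^ 2 := by nlinarith
  have hpos : 0 < (5 * c₁ * (m : ℝ)) ^ m := by positivity
  calc v ≤ C m * p * PL * W * (5 * Real.log X) := hstep1
    _ ≤ (c₁ ^ m * (m : ℝ) ^ m) * p * PL * W * (5 * Real.log X) := by
        calc C m * p * PL * W * (5 * Real.log X) = C m * (p * PL * W * (5 * Real.log X)) := by ring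
          _ ≤ (c₁ ^ m * (m : ℝ) ^ m) * (p * PL * W * (5 * Real.log X)) :=
              mul_le_mul_of_nonneg_right hCm.2 hrest0
          _ = _ := by ring
    _ = (5 * (c₁ ^ m * (m : ℝ) ^ m)) * p * (W * Real.log X * PL) := by ring
    _ ≤ (5 * c₁ * m) ^ m * p * (W * Real.log X * PL) :=
        mul_le_mul_of_nonneg_right (mul_le_mul_of_nonneg_right henv hpR0.le) hA0.le
    _ = ((5 * c₁ * m) ^ m * (W * Real.log X * PL)) * p := by ring
    _ < ((5 * c₁ * m) ^ m * (W * Real.log X * PL)) * (p : ℝ) ^ 2 :=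
        mul_lt_mul_of_pos_left hpp (mul_pos hpos hA0)
    _ = (5 * c₁ * m) ^ m * (p : ℝ) ^ 2 * W * Real.log X * PL := by ring


/-- **`YuNinetyOneModFour` from the ODD engine** (`P p := p ≠ 2`): crux stmt-ABC-19250 BY NAME.
[folklore] -/
theorem padicPrimesYuNinety_oneModFour_of_oddEngine
    (hE : ∃ (C : ℕ → ℝ) (c₁ : ℝ), 1 ≤ c₁ ∧ (∀ m, 0 ≤ C m ∧ C m ≤ c₁ ^ m * (m : ℝ) ^ m) ∧
      ∀ (p : ℕ), p.Prime → p ≠ 2 → ∀ (m : ℕ) (α : Fin m → ℚ) (b : Fin m → ℤ) (V : Fin m → ℝ)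
        (Vmax W : ℝ),
        (∀ j, α j ≠ 0 ∧ padicValRat p (α j) = 0) →
        (∀ μ : Fin m → ℤ, ∏ j, α j ^ μ j = 1 → μ = 0) →
        (∀ T : Finset (Fin m), T.Nonempty → ¬ IsSquare (∏ j ∈ T, α j) ∧ ¬ IsSquare (-∏ j ∈ T, α j)) →
        (∀ j, Height.logHeight₁ (α j) ≤ V j) → (∀ j, Real.log p ≤ V j) → (∀ j, V j ≤ Vmax) →
        b ≠ 0 → (∀ j, Real.log (max 3 (|b j| : ℝ)) ≤ W) →
        (padicValRat p (∏ j, α j ^ b j - 1) : ℝ) ≤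
          C m * p * (∏ j, V j / Real.log p) * W * (Real.log Vmax + Real.log p) / Real.log p ^ 2) :
    Summit.ABC.ABC.Theses.PadicPrimesYuNinety.YuNinetyOneModFour := by
  obtain ⟨C, c₁, hc₁, hC, hA⟩ := hE
  obtain ⟨c₅, h⟩ := padicPrimesYuNinety_residueClass_of_engine (fun p => p % 4 = 1) (by norm_num)
    ⟨C, c₁, hc₁, hC, fun p hp hp4 => hA p hp (by omega)⟩
  exact ⟨c₅, h⟩

/-- **`YuNinetyThreeModFour` from the ODD engine** (`P p := p ≠ 2`): crux stmt-ABC-19249 BY NAME.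
[folklore] -/
theorem padicPrimesYuNinety_threeModFour_of_oddEngine
    (hE : ∃ (C : ℕ → ℝ) (c₁ : ℝ), 1 ≤ c₁ ∧ (∀ m, 0 ≤ C m ∧ C m ≤ c₁ ^ m * (m : ℝ) ^ m) ∧
      ∀ (p : ℕ), p.Prime → p ≠ 2 → ∀ (m : ℕ) (α : Fin m → ℚ) (b : Fin m → ℤ) (V : Fin m → ℝ)
        (Vmax W : ℝ),
        (∀ j, α j ≠ 0 ∧ padicValRat p (α j) = 0) →
        (∀ μ : Fin m → ℤ, ∏ j, α j ^ μ j = 1 → μ = 0) →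
        (∀ T : Finset (Fin m), T.Nonempty → ¬ IsSquare (∏ j ∈ T, α j) ∧ ¬ IsSquare (-∏ j ∈ T, α j)) →
        (∀ j, Height.logHeight₁ (α j) ≤ V j) → (∀ j, Real.log p ≤ V j) → (∀ j, V j ≤ Vmax) →
        b ≠ 0 → (∀ j, Real.log (max 3 (|b j| : ℝ)) ≤ W) →
        (padicValRat p (∏ j, α j ^ b j - 1) : ℝ) ≤
          C m * p * (∏ j, V j / Real.log p) * W * (Real.log Vmax + Real.log p) / Real.log p ^ 2) :
    Summit.ABC.ABC.Theses.PadicPrimesYuNinety.YuNinetyThreeModFour := by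
  obtain ⟨C, c₁, hc₁, hC, hA⟩ := hE
  obtain ⟨c₅, h⟩ := padicPrimesYuNinety_residueClass_of_engine (fun p => p % 4 = 3) (by norm_num)
    ⟨C, c₁, hc₁, hC, fun p hp hp4 => hA p hp (by omega)⟩
  exact ⟨c₅, h⟩

/-- **`YuNinetyOneModFour` from an engine stated at `p ≡ 1 (mod 4)` only** (the `K = ℚ` analogue
of the skeleton's `EngineThreeModFour` at the other residue class). [folklore] -/
theorem padicPrimesYuNinety_oneModFour_of_engineOne
    (hE : ∃ (C : ℕ → ℝ) (c₁ : ℝ), 1 ≤ c₁ ∧ (∀ m, 0 ≤ C m ∧ C m ≤ c₁ ^ m * (m : ℝ) ^ m) ∧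
      ∀ (p : ℕ), p.Prime → p % 4 = 1 → ∀ (m : ℕ) (α : Fin m → ℚ) (b : Fin m → ℤ) (V : Fin m → ℝ)
        (Vmax W : ℝ),
        (∀ j, α j ≠ 0 ∧ padicValRat p (α j) = 0) →
        (∀ μ : Fin m → ℤ, ∏ j, α j ^ μ j = 1 → μ = 0) →
        (∀ T : Finset (Fin m), T.Nonempty → ¬ IsSquare (∏ j ∈ T, α j) ∧ ¬ IsSquare (-∏ j ∈ T, α j)) →
        (∀ j, Height.logHeight₁ (α j) ≤ V j) → (∀ j, Real.log p ≤ V j) → (∀ j, V j ≤ Vmax) →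
        b ≠ 0 → (∀ j, Real.log (max 3 (|b j| : ℝ)) ≤ W) →
        (padicValRat p (∏ j, α j ^ b j - 1) : ℝ) ≤
          C m * p * (∏ j, V j / Real.log p) * W * (Real.log Vmax + Real.log p) / Real.log p ^ 2) :
    Summit.ABC.ABC.Theses.PadicPrimesYuNinety.YuNinetyOneModFour := by
  obtain ⟨c₅, h⟩ := padicPrimesYuNinety_residueClass_of_engine (fun p => p % 4 = 1) (by norm_num) hE
  exact ⟨c₅, h⟩

end Summit.ABC.ABC.Theorems

end
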